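import Summits.QuantumFields.YangMills.Theorems.BalabanUVNodesN15BackwardShift
import HarnessLib

/-!
# Route «BalabanUVNodes» (K4 «SpineRates»), node N15 = NE2, BACKGROUND LAYER — THE PRINT's `V′₁(A)` WITH THE GAUGE FIELD ITSELF AS THE DATUM: the carrier of
# ONE `𝔄`-valued gauge field `A′` with unit-scale C² letters (sup, first and second lattice differences — our unit-scale reading of the printed pair (3.35) ∧ (3.36)), the three fields
# `(A⁺, A⁻, W) = (A′, A′(· − e_μ), ∇′*A′)` DERIVED from it, the pairing, the kernel family, and the realised instance at the vector piece ⊗ 1_𝔤 (data)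

Cell `pub-ymgap`, seat `pub-ymgap-dag-n15-c` (generation g3; R134 ACCELERATION SEAT, strategy s1; HUMAN RULING D-0062; chair R424 venue; `bears_on: R4∕N15`).
Filed `--supports stmt-QuantumFields-19908 --as helper` (K3′; lineage tag on the definition lane).  Imports BY NAME, nothing in the tree modified: this seat's
`…N15BackwardShift` (§4 data `dPieces`, `mPieces`; through it V1b∕V2 `…N15BackgroundV1Species`∕`…ByName`: `v1Bg`, `v1fieldsOfGauge`, `v1Ops4`, `fineGeo`,
G1 `gavgM`∕`gavgM_zero`, M4 `tensorId`, n15-a's `pieceG`∕`pieceS`∕`pieceD3`, `unitTorusGeoS`, `thetaV`, `VecIndexS`, `blkFine`, `kingPrV`).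

WHY (referees' D1 notes on V1b∕V2, this seat's g2∕g3 HONEST FRAMING: «the three fields `(A⁺, A⁻, W)` are carried INDEPENDENTLY — their joint origin in one `A′`
is a def (`v1fieldsOfGauge`), not a constraint»).  THIS FILE makes the gauge field the datum: configurations are `A′ : J → X′ → 𝔄` on a lattice with unit
shifts `s′_μ : X′ ≃ X′` and spacing `η′`; the (3.35) slot `Reg335 c α₀ A′` is THE UNIT-SCALE C² LETTER TRIPLE `‖A′‖ ≤ cMα₀`, `‖A′(· + e_κ) − A′‖ ≤ cMα₀·η′`,
`‖(A′(· + e_κ) − A′) − (A′(· + e_κ) − A′)(· − e_μ)‖ ≤ cMα₀·η′²` (the printed pair «|A| < O(1)Mα₀(L^jη)^{−1}, |∇^ηA| < O(1)Mα₀(L^jη)^{−2}» at the unit scale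
`L^jη = 1`, together with (3.36) «|∂^η∂^ηA| < O(1)Mα₀(L^jη)^{−3}» — the printed C² pair, the unit-scale reading OURS); the kernel family is V2's `v1Ops4` AT THE DERIVED TRIPLE
`v1fieldsOfGauge s′ η′ A′ = (A′, A′∘s′⁻¹, Σ_μ η′⁻¹(A′_μ − A′_μ∘s′_μ⁻¹))`.  The sequel `…N15BackgroundV1GaugeByName` proves that the C² letters IMPLY V1b's letters for
the derived triple (fibrewise oscillation from per-step bounds along King's block walks) and hence `NE2PlusOperator` BY NAME with `A′` live; here: data only.

CONTENTS (8 defs, `rfl`∕`Iff.rfl` faces; no `Prop`-valued def).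
* §1 `v1GaugeBg` (the C²-letter gauge carrier; `reg335_v1GaugeBg_iff`), `v1GaugePairing` (transport = fibrewise mean `gavgM`), `v1GaugeInstance` (`_M`: guard LIVE).
* §2 `v1GOps4` (`= v1Ops4 … (v1fieldsOfGauge s′ η′ A′)`; `v1GOps4_apply`), `v1GFamily4`.
* §3 (namespace `…N15.VectorPiece`) `bshiftEquiv` (the bond shift `(x, a) ↦ (x + e_κ, a)` as an equivalence; `_apply`, `_symm_apply`), `v1GVecInstance`, `v1GVecFamily4`
  (the -a pieces ⊗ 1_𝔤, derived pieces `dPieces`, mixed `mPieces`, `ν_j = inl j.ν`), `v1GVecInstance_gf_M`, `reg335_v1GVec_iff`.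

HONEST FRAMING ∕ LIMITS.  Data and `rfl` faces only.  The C² letters are OUR unit-scale reading of the printed C² pair (3.35) ∧ (3.36), NOT the printed text; the transport is the
fibrewise mean of `A′` (linearised (C3)), and the COARSE triple is the fibrewise mean of the fine triple (V2's `v1Ops4`), not the triple of the mean field; `V′₂`
of (3.55)–(3.62) and `F′_{1,k}` NOT included; `𝔤 ↦ 𝔄` with coordinates.  NE2⁺ NOT PRINTED, NOT proved; count-neutral (typed 28∕28 · discharged unchanged);
N15 NOT discharged; one finite T⁴ at fixed ε — NOT infinite volume, NOT OS on ℝ⁴, NOT a mass gap, NOT Clay.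
-/

noncomputable section

open scoped BigOperators

namespace Summit.QuantumFields.YangMills.BalabanUVNodes.N15.BackgroundLayer

open Literature.MathematicalPhysics.QuantumFieldTheory.Balaban1983to89
open Literature.MathematicalPhysics.QuantumFieldTheory.Balaban1983to89.B11SectG (BlockNorm HasMaj)
open Literature.MathematicalPhysics.QuantumFieldTheory.Balaban1983to89.T4EtaRate (PairedInstance EtaPairing)
open Literature.MathematicalPhysics.QuantumFieldTheory.Balaban1983to89.T4EtaRateDefect (idef)
open Literature.MathematicalPhysics.QuantumFieldTheory.Balaban1983to89.T4EtaRateCoeffDefect (pull)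
open Summit.QuantumFields.YangMills.BalabanUVNodes.N15.OperatorReadout (opGeo opFamily)
open Summit.QuantumFields.YangMills.BalabanUVNodes.N15.MatrixSpecies (liftMap liftBlk)

/-! ## §1 The C²-letter gauge carrier, the pairing, the instance -/

section Carrier

variable {X X' : Type} (𝔄 J : Type) [NormedAddCommGroup 𝔄] [NormedSpace ℝ 𝔄]

/-- THE GAUGE CARRIER WITH UNIT-SCALE C² LETTERS: configurations = `𝔄`-valued gauge fields `A : J → X → 𝔄` on a lattice with unit shifts `s_μ : X ≃ X` and
spacing `η`; `one := 0`, `mul := (+)`; `Reg335 c α₀ A` = `‖A_μ(x)‖ ≤ cMα₀` ∧ `‖A_μ(x + e_κ) − A_μ(x)‖ ≤ cMα₀·η` ∧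
`‖(A_μ(x + e_κ) − A_μ(x)) − (A_μ(x − e_μ + e_κ) − A_μ(x − e_μ))‖ ≤ cMα₀·η²`; `Reg336` repeats it; (3.37)–(3.38) inert. [cite: Balaban1985BackgroundPropagators, (3.35)–(3.36) p.396 («|A| < O(1)Mα₀(L^jη)^{−1}, |∇^ηA| < O(1)Mα₀(L^jη)^{−2}», «|∂^η∂^ηA| < O(1)Mα₀(L^jη)^{−3}»: shapes, read at the unit scale)] -/
def v1GaugeBg (s : J → X ≃ X) (η M : ℝ) : B9.Backgrounds where
  Cfg := J → X → 𝔄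
  one := 0
  mul := fun A₁ A₂ => A₁ + A₂
  Reg335 := fun c α₀ A => (∀ μ x, ‖A μ x‖ ≤ c * M * α₀) ∧ (∀ μ κ x, ‖A μ (s κ x) - A μ x‖ ≤ c * M * α₀ * η) ∧
    ∀ μ κ x, ‖(A μ (s κ x) - A μ x) - (A μ (s κ ((s μ).symm x)) - A μ ((s μ).symm x))‖ ≤ c * M * α₀ * η * η
  Reg336 := fun c α₀ A => (∀ μ x, ‖A μ x‖ ≤ c * M * α₀) ∧ (∀ μ κ x, ‖A μ (s κ x) - A μ x‖ ≤ c * M * α₀ * η) ∧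
    ∀ μ κ x, ‖(A μ (s κ x) - A μ x) - (A μ (s κ ((s μ).symm x)) - A μ ((s μ).symm x))‖ ≤ c * M * α₀ * η * η
  Cplx337 := fun _ _ _ => True
  Cplx338 := fun _ _ _ => True

omit [NormedSpace ℝ 𝔄] in
/-- Unfolding of the carrier's (3.35). [folklore] -/
theorem reg335_v1GaugeBg_iff (s : J → X ≃ X) (η M c α₀ : ℝ) (A : J → X → 𝔄) :
    (v1GaugeBg 𝔄 J s η M).Reg335 c α₀ A ↔
      (∀ μ x, ‖A μ x‖ ≤ c * M * α₀) ∧ (∀ μ κ x, ‖A μ (s κ x) - A μ x‖ ≤ c * M * α₀ * η) ∧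
        ∀ μ κ x, ‖(A μ (s κ x) - A μ x) - (A μ (s κ ((s μ).symm x)) - A μ ((s μ).symm x))‖ ≤ c * M * α₀ * η * η := Iff.rfl

variable [Fintype X'] [DecidableEq X] {g : B6.Geometry} [Fintype X] (ι : Type) [Fintype ι]

/-- THE η-PAIRING over the gauge carriers on the product carrier `X × ι`: coarse spacing `η`, fine spacing `η′ = η·L^{−n}`, transport = fibrewise mean of the gauge
field (G1's `gavgM`; linearised (C3)). [cite: King1986, p.664 (convention before Prop. 3.8)] -/
def v1GaugePairing (blk : X → g.Site) (π : X' → X) (s : J → X ≃ X) (s' : J → X' ≃ X') (n : ℕ) (hL : g.L ≠ 0) :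
    EtaPairing (opGeo g (X × ι) (liftBlk blk ι)) (fineGeo g (X' × ι) (liftBlk (blk ∘ π) ι) n) (v1GaugeBg 𝔄 J s g.eta g.M)
      (v1GaugeBg 𝔄 J s' (g.eta * (g.L ^ n)⁻¹) g.M) where
  n := n
  k_eq := rfl
  L_eq := rfl
  M_eq := rfl
  eta_eq := by
    show g.eta * (g.L ^ n)⁻¹ * g.L ^ n = g.eta
    rw [mul_assoc, inv_mul_cancel₀ (pow_ne_zero _ hL), mul_one]
  ι := fun y => y
  scale_ι := fun _ => rfl
  dist_ι := fun _ _ => rfl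
  τ := fun lam => pull (liftMap π ι) lam
  suppIn_τ := fun _ _ h p hp => h (liftMap π ι p) hp
  supNorm_τ := fun lam => by
    show (⨆ p : X' × ι, |lam (liftMap π ι p)|) ≤ ⨆ p : X × ι, |lam p|
    exact Real.iSup_le (fun p => abs_le_iSup_abs lam (liftMap π ι p)) (Real.iSup_nonneg fun p => abs_nonneg _)
  avg := gavgM 𝔄 J π
  avg_one := gavgM_zero 𝔄 J π

/-- THE REALISED PAIRED INSTANCE over the C²-letter gauge carriers. [cite: Balaban1985BackgroundPropagators, Thm 3.14 pp.426–427 (typing template)] -/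
def v1GaugeInstance (blk : X → g.Site) (π : X' → X) (s : J → X ≃ X) (s' : J → X' ≃ X') (n : ℕ) (hL : g.L ≠ 0) : PairedInstance :=
  ⟨opGeo g (X × ι) (liftBlk blk ι), fineGeo g (X' × ι) (liftBlk (blk ∘ π) ι) n, v1GaugeBg 𝔄 J s g.eta g.M,
    v1GaugeBg 𝔄 J s' (g.eta * (g.L ^ n)⁻¹) g.M, v1GaugePairing 𝔄 J ι blk π s s' n hL⟩

/-- THE GUARD IS LIVE. [folklore] -/
theorem v1GaugeInstance_M (blk : X → g.Site) (π : X' → X) (s : J → X ≃ X) (s' : J → X' ≃ X') (n : ℕ) (hL : g.L ≠ 0) :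
    (v1GaugeInstance 𝔄 J ι blk π s s' n hL).gf.M = g.M := rfl

end Carrier

/-! ## §2 The kernel family: V2's four entries AT THE DERIVED TRIPLE -/

section Family

variable {X X' J ι : Type} [Fintype X] [Fintype X'] [Fintype J] [Fintype ι] [DecidableEq X] [DecidableEq X'] [DecidableEq J] [DecidableEq ι]
  {𝔄 : Type} [NormedRing 𝔄] [NormedAlgebra ℝ 𝔄] [CompleteSpace 𝔄] (e : 𝔄 ≃L[ℝ] (ι → ℝ)) {g : B6.Geometry} (blk : X → g.Site) (π : X' → X)

/-- THE FOUR ENTRY OPERATORS AT A GAUGE FIELD `A′`: V2's `v1Ops4` at the derived triple `v1fieldsOfGauge s′ η′ A′ = (A′, A′∘s′⁻¹, ∇′*A′)` (coarse side = its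
fibrewise mean). [cite: Balaban1985BackgroundPropagators, (3.42) p.397, (3.52) p.400 (shapes)] -/
def v1GOps4 (s' : J → X' ≃ X') (η η' : ℝ) (ν : J ⊕ J) (G S D₃ : (X × ι → ℝ) →ₗ[ℝ] (X × ι → ℝ)) (D SD : J ⊕ J → (X × ι → ℝ) →ₗ[ℝ] (X × ι → ℝ))
    (G' S' D₃' : (X' × ι → ℝ) →ₗ[ℝ] (X' × ι → ℝ)) (D' SD' : J ⊕ J → (X' × ι → ℝ) →ₗ[ℝ] (X' × ι → ℝ)) :
    Fin 4 → (J → X' → 𝔄) → ((X × ι → ℝ) →ₗ[ℝ] (X' × ι → ℝ)) :=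
  fun n A' => v1Ops4 e π η η' ν G S D₃ D SD G' S' D₃' D' SD' n (v1fieldsOfGauge 𝔄 J s' η' A')

omit [CompleteSpace 𝔄] in
/-- Unfolding. [folklore] -/
@[simp] theorem v1GOps4_apply (s' : J → X' ≃ X') (η η' : ℝ) (ν : J ⊕ J) (G S D₃ : (X × ι → ℝ) →ₗ[ℝ] (X × ι → ℝ))
    (D SD : J ⊕ J → (X × ι → ℝ) →ₗ[ℝ] (X × ι → ℝ)) (G' S' D₃' : (X' × ι → ℝ) →ₗ[ℝ] (X' × ι → ℝ))
    (D' SD' : J ⊕ J → (X' × ι → ℝ) →ₗ[ℝ] (X' × ι → ℝ)) (n : Fin 4) (A' : J → X' → 𝔄) :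
    v1GOps4 e π s' η η' ν G S D₃ D SD G' S' D₃' D' SD' n A' = v1Ops4 e π η η' ν G S D₃ D SD G' S' D₃' D' SD' n (v1fieldsOfGauge 𝔄 J s' η' A') := rfl

/-- THE KERNEL FAMILY over the gauge carrier (g0 `opFamily` on the product carrier), spacings `η = g.eta`, `η′ = η·(L^n)⁻¹`. [cite: Balaban1985BackgroundPropagators, (3.42) p.397 (shape)] -/
def v1GFamily4 (s : J → X ≃ X) (s' : J → X' ≃ X') (n : ℕ) (hL : g.L ≠ 0) (ν : J ⊕ J) (G S D₃ : (X × ι → ℝ) →ₗ[ℝ] (X × ι → ℝ))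
    (D SD : J ⊕ J → (X × ι → ℝ) →ₗ[ℝ] (X × ι → ℝ)) (G' S' D₃' : (X' × ι → ℝ) →ₗ[ℝ] (X' × ι → ℝ)) (D' SD' : J ⊕ J → (X' × ι → ℝ) →ₗ[ℝ] (X' × ι → ℝ)) :
    B9.KernelFamily (v1GaugeInstance 𝔄 J ι blk π s s' n hL).gc (v1GaugeInstance 𝔄 J ι blk π s s' n hL).Bf :=
  show B9.KernelFamily (opGeo g (X × ι) (liftBlk blk ι)) (v1GaugeBg 𝔄 J s' (g.eta * (g.L ^ n)⁻¹) g.M) from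
    opFamily (g := g) (B := v1GaugeBg 𝔄 J s' (g.eta * (g.L ^ n)⁻¹) g.M) (liftBlk blk ι) (liftBlk (blk ∘ π) ι)
      (v1GOps4 e π s' g.eta (g.eta * (g.L ^ n)⁻¹) ν G S D₃ D SD G' S' D₃' D' SD')

end Family

end Summit.QuantumFields.YangMills.BalabanUVNodes.N15.BackgroundLayer

/-! ## §3 The realised instance family at the vector piece ⊗ 1_𝔤 -/

namespace Summit.QuantumFields.YangMills.BalabanUVNodes.N15.VectorPiece

open Literature.MathematicalPhysics.QuantumFieldTheory.Balaban1983to89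
open Literature.MathematicalPhysics.QuantumFieldTheory.Balaban1983to89.T4EtaRate (PairedInstance)
open Literature.MathematicalPhysics.QuantumFieldTheory.Balaban1983to89.B5Prop11Plancherel (Tor fine unitVec)
open Summit.QuantumFields.YangMills.BalabanUVNodes.N15.BackgroundLayer (v1GaugeInstance v1GFamily4)

variable {d : ℕ}

section Realised

variable (M : Fin (d + 1) → ℕ) (n : ℕ)

/-- THE BOND SHIFT `(x, a) ↦ (x + e_κ, a)` of the level-`n` fine 1-forms' index set, as an equivalence (inverse `(x, a) ↦ (x − e_κ, a)`, the map `bshiftV` pulls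
back along). [folklore] -/
def bshiftEquiv (κ : Fin (d + 1)) : (Tor (fine n M) × Fin (d + 1)) ≃ (Tor (fine n M) × Fin (d + 1)) where
  toFun i := (i.1 + unitVec (fine n M) κ, i.2)
  invFun i := (i.1 - unitVec (fine n M) κ, i.2)
  left_inv i := by simp
  right_inv i := by simp

/-- Unfolding. [folklore] -/
@[simp] theorem bshiftEquiv_apply (κ : Fin (d + 1)) (i : Tor (fine n M) × Fin (d + 1)) :
    bshiftEquiv M n κ i = (i.1 + unitVec (fine n M) κ, i.2) := rfl

/-- Unfolding of the inverse. [folklore] -/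
@[simp] theorem bshiftEquiv_symm_apply (κ : Fin (d + 1)) (i : Tor (fine n M) × Fin (d + 1)) :
    (bshiftEquiv M n κ).symm i = (i.1 - unitVec (fine n M) κ, i.2) := rfl

variable (𝔄 : Type) [NormedRing 𝔄] [NormedAlgebra ℝ 𝔄] [CompleteSpace 𝔄] (ι : Type) [Fintype ι] [DecidableEq ι] (e : 𝔄 ≃L[ℝ] (ι → ℝ)) (L : ℕ) [NeZero L]

/-- THE REALISED GAUGE INSTANCE at a sized index: the C²-letter gauge carriers over the sized unit-torus carrier on the product carrier `X × ι`, blocks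
`liftBlk blkFine ι`, King's pairing, bond shifts `bshiftEquiv` at both levels, scale shift `m`. [cite: Balaban1985BackgroundPropagators, Thm 3.14 pp.426–427 (typing template); (3.35) p.396 (shape)] -/
def v1GVecInstance (hL : 1 ≤ L) (j : VecIndexS d L) : PairedInstance :=
  v1GaugeInstance 𝔄 (Fin (d + 1)) ι (g := unitTorusGeoS L j.k j.Mn j.Msz) (blkFine L j.k j.Mn) (kingPrV L j.k j.m j.Mn) (bshiftEquiv j.Mn (L ^ j.k))
    (bshiftEquiv j.Mn (L ^ j.m * L ^ j.k)) j.m (unitTorusGeoS_L_ne_zero L hL j)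

/-- THE REALISED GAUGE KERNEL FAMILY: `v1GFamily4` fed with the -a pieces ⊗ 1_𝔤 — `G`, `G∂_ν*`, `(Δ−∂∂*)G`, derived `dPieces` (forward AND backward), mixed
`mPieces` — at both spacings; entry-1 direction `inl j.ν`. [cite: Balaban1985BackgroundPropagators, (3.42) p.397, (3.44) p.398, (3.52) p.400, (3.63)–(3.65) pp.402–403 (shapes, mechanism)] -/
def v1GVecFamily4 (hL : 1 ≤ L) (j : VecIndexS d L) :
    B9.KernelFamily (v1GVecInstance (d := d) 𝔄 ι L hL j).gc (v1GVecInstance (d := d) 𝔄 ι L hL j).Bf :=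
  v1GFamily4 e (g := unitTorusGeoS L j.k j.Mn j.Msz) (blkFine L j.k j.Mn) (kingPrV L j.k j.m j.Mn) (bshiftEquiv j.Mn (L ^ j.k))
    (bshiftEquiv j.Mn (L ^ j.m * L ^ j.k)) j.m (unitTorusGeoS_L_ne_zero L hL j) (Sum.inl j.ν)
    (tensorId ι (pieceG L j.Mn (L ^ j.k) j.k (rweight (d := d) L j.k))) (tensorId ι (pieceS L j.Mn (L ^ j.k) j.k (rweight (d := d) L j.k) j.ν))
    (tensorId ι (pieceD3 L j.Mn (L ^ j.k) j.k (rweight (d := d) L j.k)))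
    (fun μ => tensorId ι (dPieces L j.Mn (L ^ j.k) j.k (rweight (d := d) L j.k) μ))
    (fun μ => tensorId ι (mPieces L j.Mn (L ^ j.k) j.k (rweight (d := d) L j.k) j.ν μ))
    (tensorId ι (pieceG L j.Mn (L ^ j.m * L ^ j.k) (j.k + j.m) (rweight (d := d) L j.k / ((L : ℝ) ^ j.m) ^ (d + 1))))
    (tensorId ι (pieceS L j.Mn (L ^ j.m * L ^ j.k) (j.k + j.m) (rweight (d := d) L j.k / ((L : ℝ) ^ j.m) ^ (d + 1)) j.ν))
    (tensorId ι (pieceD3 L j.Mn (L ^ j.m * L ^ j.k) (j.k + j.m) (rweight (d := d) L j.k / ((L : ℝ) ^ j.m) ^ (d + 1))))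
    (fun μ => tensorId ι (dPieces L j.Mn (L ^ j.m * L ^ j.k) (j.k + j.m) (rweight (d := d) L j.k / ((L : ℝ) ^ j.m) ^ (d + 1)) μ))
    (fun μ => tensorId ι (mPieces L j.Mn (L ^ j.m * L ^ j.k) (j.k + j.m) (rweight (d := d) L j.k / ((L : ℝ) ^ j.m) ^ (d + 1)) j.ν μ))

omit [DecidableEq ι] [CompleteSpace 𝔄] in
/-- **THE GUARD IS LIVE**: the fine realised gauge instance's [B9] size parameter IS the index's `M`. [folklore] -/
theorem v1GVecInstance_gf_M (hL : 1 ≤ L) (j : VecIndexS d L) : (v1GVecInstance (d := d) 𝔄 ι L hL j).gf.M = j.Msz := rfl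

omit [DecidableEq ι] [CompleteSpace 𝔄] in
/-- WHAT (3.35) SAYS HERE: a fine gauge field `A′ : Fin (d+1) → X′ → 𝔄` (fine bonds `X′`, spacing `η′ = L^{−k}·L^{−m}`) is `Reg335 c₃₅ α₀`-regular iff, in the norm
of `𝔄`, `‖A′_μ‖ ≤ c₃₅·M·α₀`, its one-step differences are `≤ c₃₅·M·α₀·η′` and its second differences `≤ c₃₅·M·α₀·η′²` — bounded, Lipschitz and C² AT THE UNIT
SCALE, with the index's OWN `M`. [cite: Balaban1985BackgroundPropagators, (3.35)–(3.36) p.396 (shapes; unit-scale reading ours)] -/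
theorem reg335_v1GVec_iff (hL : 1 ≤ L) (j : VecIndexS d L) (c35 α₀ : ℝ) (A' : Fin (d + 1) → Tor (fine (L ^ j.m * L ^ j.k) j.Mn) × Fin (d + 1) → 𝔄) :
    (v1GVecInstance (d := d) 𝔄 ι L hL j).Bf.Reg335 c35 α₀ A' ↔
      (∀ μ x', ‖A' μ x'‖ ≤ c35 * j.Msz * α₀) ∧
        (∀ μ κ x', ‖A' μ (x'.1 + unitVec (fine (L ^ j.m * L ^ j.k) j.Mn) κ, x'.2) - A' μ x'‖ ≤
          c35 * j.Msz * α₀ * (((L : ℝ) ^ j.k)⁻¹ * (((L : ℝ) ^ j.m)⁻¹))) ∧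
        ∀ μ κ x', ‖(A' μ (x'.1 + unitVec (fine (L ^ j.m * L ^ j.k) j.Mn) κ, x'.2) - A' μ x') -
            (A' μ (x'.1 - unitVec (fine (L ^ j.m * L ^ j.k) j.Mn) μ + unitVec (fine (L ^ j.m * L ^ j.k) j.Mn) κ, x'.2) -
              A' μ (x'.1 - unitVec (fine (L ^ j.m * L ^ j.k) j.Mn) μ, x'.2))‖ ≤
          c35 * j.Msz * α₀ * (((L : ℝ) ^ j.k)⁻¹ * (((L : ℝ) ^ j.m)⁻¹)) * (((L : ℝ) ^ j.k)⁻¹ * (((L : ℝ) ^ j.m)⁻¹)) :=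
  Iff.rfl

end Realised

end Summit.QuantumFields.YangMills.BalabanUVNodes.N15.VectorPiece

end
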